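import Mathlib
import HarnessLib
import Summits.AtomisticToContinuum.FouriersLaw.Theses.JunctionLocality

/-!
# Strategy census S2 for crux `JunctionLocality.ConductanceLowerBound` (stmt-AtomisticToContinuum-11749) —
typed companions of `STRATEGY-CENSUS-s2.md` (crux-strategist seat `cstrat-stmt-AtomisticToContinuum-11749-s2`, 2026-08-17)

Second strategist pass.  This file TYPES the new candidate strengthening and the new candidate
decomposition named in the s2 census over the existing declarations, and PROVES the elementary
glue implications the census quotes.  Nothing here is a line: no `stub_*`, no composition to the
crux is registered; the live skeleton `Lines/ForecastSensitivitySketch.lean` is untouched.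

Device.  `InFrame P` is the crux's quantifier prefix (parameters `> 0`, weak-NESS uniqueness,
a steady-state family, `T > 0`, response coefficients `D`) ending in a property `P D` of the
response SEQUENCE; `ConductanceLowerBound = InFrame LowerSeq` and `PositiveConductance = InFrame PosSeq`
definitionally, so every glue statement reduces to real analysis on sequences (`inFrame_mono`,
`inFrame_and`).

Contents
* §1 frame: `InFrame`, `LowerSeq`, `PosSeq`, read-backs, monotonicity of the frame.
* §2 strengthening S2θ `AlmostMonotoneSeq` (monotone response WITH multiplicative slack θ) and
  `conductanceLowerBound_of_almostMonotone` (proved, with the closed (P) `PositiveConductance`).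
* §3 decomposition D-G `DoublingHarnackSeq ∧ DyadicFloorSeq → LowerSeq` (proved), the frame-level
  `conductanceLowerBound_of_doublingHarnack_of_dyadicFloor`, and the converse
  `dyadicFloor_of_conductanceLowerBound` recording that the dyadic piece is the crux on a subsequence.
-/

noncomputable section

open MeasureTheory Filter Topology
open Literature.MathematicalPhysics.KineticTheory.HeatConduction

namespace Summit.AtomisticToContinuum.FouriersLaw.Cruxes.ConductanceLowerBound.StrategyCensusS2

open Summit.AtomisticToContinuum.FouriersLaw.Theses.JunctionLocality

/-! ## §1 The crux frame as an operator on sequence properties -/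

/-- The quantifier prefix of the crux, ending in a property `P` of the response sequence `D`. -/
def InFrame (P : (ℕ → ℝ) → Prop) : Prop :=
  ∀ ω₂ lam β γ : ℝ, 0 < ω₂ → 0 < lam → 0 < β → 0 < γ →
    (∀ (N : ℕ) (T_L T_R : ℝ), 0 < T_L → 0 < T_R → ∀ μ ν : Measure (PhaseSpace N),
      (pinnedChain ω₂ lam β γ).IsSteadyState N T_L T_R μ →
      (pinnedChain ω₂ lam β γ).IsSteadyState N T_L T_R ν → μ = ν) →
    ∀ μ : (N : ℕ) → ℝ → ℝ → Measure (PhaseSpace N),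
      (∀ (N : ℕ) (T_L T_R : ℝ), 0 < T_L → 0 < T_R →
        (pinnedChain ω₂ lam β γ).IsSteadyState N T_L T_R (μ N T_L T_R)) →
      ∀ T : ℝ, 0 < T → ∀ D : ℕ → ℝ,
        (∀ N : ℕ, Tendsto (fun δ : ℝ =>
          (pinnedChain ω₂ lam β γ).totalCurrent (μ N (T + δ / 2) (T - δ / 2)) / δ)
            (𝓝[≠] 0) (𝓝 (D N))) → P D

/-- The crux's conclusion: `liminf_N D_N > 0`. -/
def LowerSeq (D : ℕ → ℝ) : Prop := ∃ c : ℝ, 0 < c ∧ ∃ N₁ : ℕ, ∀ N : ℕ, N₁ ≤ N → c ≤ D N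

/-- (P)'s conclusion: `D_N > 0` for `N ≥ 2`. -/
def PosSeq (D : ℕ → ℝ) : Prop := ∀ N : ℕ, 2 ≤ N → 0 < D N

/-- Read-back: the crux is `InFrame LowerSeq`. -/
theorem inFrame_lowerSeq_iff : InFrame LowerSeq ↔ ConductanceLowerBound :=
  ⟨fun h ω₂ lam β γ hω hl hβ hγ hu μ hμ T hT D hD => h ω₂ lam β γ hω hl hβ hγ hu μ hμ T hT D hD,
   fun h ω₂ lam β γ hω hl hβ hγ hu μ hμ T hT D hD => h ω₂ lam β γ hω hl hβ hγ hu μ hμ T hT D hD⟩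

/-- Read-back: (P) `PositiveConductance` is `InFrame PosSeq`. -/
theorem inFrame_posSeq_of_positiveConductance (h : PositiveConductance) : InFrame PosSeq :=
  fun ω₂ lam β γ hω hl hβ hγ hu μ hμ T hT D hD => h ω₂ lam β γ hω hl hβ hγ hu μ hμ T hT D hD

/-- The frame is monotone in the sequence property. -/
theorem inFrame_mono {P Q : (ℕ → ℝ) → Prop} (hPQ : ∀ D, P D → Q D) (h : InFrame P) : InFrame Q :=
  fun ω₂ lam β γ hω hl hβ hγ hu μ hμ T hT D hD => hPQ D (h ω₂ lam β γ hω hl hβ hγ hu μ hμ T hT D hD)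

/-- The frame commutes with conjunction. -/
theorem inFrame_and {P Q : (ℕ → ℝ) → Prop} (hP : InFrame P) (hQ : InFrame Q) :
    InFrame (fun D => P D ∧ Q D) :=
  fun ω₂ lam β γ hω hl hβ hγ hu μ hμ T hT D hD =>
    ⟨hP ω₂ lam β γ hω hl hβ hγ hu μ hμ T hT D hD, hQ ω₂ lam β γ hω hl hβ hγ hu μ hμ T hT D hD⟩

/-! ## §2 Strengthening S2θ: monotone response with multiplicative slack -/

/-- **S2θ — ALMOST-MONOTONE RESPONSE** (census §Strengthen): `∃ θ > 0, ∀ 2 ≤ N ≤ M, θ·D_N ≤ D_M`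
(lengthening the chain never destroys more than a FIXED fraction of the response coefficient;
θ = 1 is s1's `MonotoneResponse`).  In resistance language `R_M ≤ θ⁻¹·R_N·(M−1)/(N−1)`: weaker than
the subadditive series law (FeketeSeriesLaw stmt-14041) and than monotonicity, still FALSE for an
exponential insulator, hence it carries the whole anti-insulation content. -/
def AlmostMonotoneSeq (D : ℕ → ℝ) : Prop :=
  ∃ θ : ℝ, 0 < θ ∧ ∀ N M : ℕ, 2 ≤ N → N ≤ M → θ * D N ≤ D M

/-- Real-analysis glue: almost-monotone + positive ⇒ bounded below (`c := θ·D_2`). -/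
theorem lowerSeq_of_almostMonotone {D : ℕ → ℝ} (hA : AlmostMonotoneSeq D) (hP : PosSeq D) :
    LowerSeq D := by
  obtain ⟨θ, hθ, hA⟩ := hA
  exact ⟨θ * D 2, mul_pos hθ (hP 2 le_rfl), 2, fun N hN => hA 2 N le_rfl hN⟩

/-- **`InFrame AlmostMonotoneSeq → PositiveConductance → ConductanceLowerBound`** (proved; (P) is the
closed item stmt-11750). -/
theorem conductanceLowerBound_of_almostMonotone
    (hA : InFrame AlmostMonotoneSeq) (hP : PositiveConductance) : ConductanceLowerBound :=
  inFrame_lowerSeq_iff.mp <|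
    inFrame_mono (fun _ h => lowerSeq_of_almostMonotone h.1 h.2)
      (inFrame_and hA (inFrame_posSeq_of_positiveConductance hP))

/-! ## §3 Decomposition D-G: doubling Harnack in `N` ∧ the floor along dyadic lengths -/

/-- **DOUBLING HARNACK IN THE LENGTH** (census §Decomposition, piece 1): `∃ θ > 0, ∀ 2 ≤ N ≤ M ≤ 2N,
θ·D_N ≤ D_M` — at most a fixed fraction of the response is lost when the chain is lengthened by a
factor `≤ 2`.  Alone (with (P)) it gives only the POLYNOMIAL lower bound `D_N ≥ D_2·N^{−log₂(1/θ)}`;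
it is false for an exponential insulator. -/
def DoublingHarnackSeq (D : ℕ → ℝ) : Prop :=
  ∃ θ : ℝ, 0 < θ ∧ ∀ N M : ℕ, 2 ≤ N → N ≤ M → M ≤ 2 * N → θ * D N ≤ D M

/-- **DYADIC FLOOR** (census §Decomposition, piece 2): the crux's conclusion along the lengths `2^k`
only.  This is the piece that REMAINS THE WHOLE CRUX (`dyadicFloor_of_conductanceLowerBound` and no
mechanism distinguishes dyadic lengths). -/
def DyadicFloorSeq (D : ℕ → ℝ) : Prop :=
  ∃ c : ℝ, 0 < c ∧ ∃ k₀ : ℕ, ∀ k : ℕ, k₀ ≤ k → c ≤ D (2 ^ k)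

/-- Real-analysis glue of D-G: doubling Harnack + dyadic floor ⇒ the floor at every length
(`M ∈ [2^k, 2^{k+1})`, `θ·c ≤ θ·D_{2^k} ≤ D_M`). -/
theorem lowerSeq_of_doublingHarnack_of_dyadicFloor {D : ℕ → ℝ}
    (hH : DoublingHarnackSeq D) (hF : DyadicFloorSeq D) : LowerSeq D := by
  obtain ⟨θ, hθ, hH⟩ := hH
  obtain ⟨c, hc, k₀, hk₀⟩ := hF
  refine ⟨θ * c, mul_pos hθ hc, 2 ^ (k₀ + 1), fun M hM => ?_⟩
  have h1M : 1 ≤ 2 ^ (k₀ + 1) := Nat.one_le_two_pow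
  have hM0 : M ≠ 0 := by omega
  have hlow : 2 ^ Nat.log 2 M ≤ M := Nat.pow_log_le_self 2 hM0
  have hup : M < 2 ^ (Nat.log 2 M + 1) := Nat.lt_pow_succ_log_self one_lt_two M
  have hk : k₀ + 1 ≤ Nat.log 2 M := Nat.le_log_of_pow_le one_lt_two hM
  have h2 : 2 ≤ 2 ^ Nat.log 2 M :=
    calc (2 : ℕ) = 2 ^ 1 := by norm_num
      _ ≤ 2 ^ Nat.log 2 M := Nat.pow_le_pow_right two_pos (by omega)
  have hup' : M ≤ 2 * 2 ^ Nat.log 2 M := by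
    have : 2 ^ (Nat.log 2 M + 1) = 2 * 2 ^ Nat.log 2 M := by ring
    omega
  calc θ * c ≤ θ * D (2 ^ Nat.log 2 M) :=
        mul_le_mul_of_nonneg_left (hk₀ (Nat.log 2 M) (by omega)) hθ.le
    _ ≤ D M := hH (2 ^ Nat.log 2 M) M h2 hlow hup'

/-- **`InFrame DoublingHarnackSeq → InFrame DyadicFloorSeq → ConductanceLowerBound`** (the typed split
D-G with its glue proved). -/
theorem conductanceLowerBound_of_doublingHarnack_of_dyadicFloor
    (hH : InFrame DoublingHarnackSeq) (hF : InFrame DyadicFloorSeq) : ConductanceLowerBound :=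
  inFrame_lowerSeq_iff.mp <|
    inFrame_mono (fun _ h => lowerSeq_of_doublingHarnack_of_dyadicFloor h.1 h.2) (inFrame_and hH hF)

/-- The dyadic piece is implied by the crux (it is the crux along a subsequence): `k₀ := N₁`,
using `k < 2^k`. -/
theorem dyadicFloorSeq_of_lowerSeq {D : ℕ → ℝ} (h : LowerSeq D) : DyadicFloorSeq D := by
  obtain ⟨c, hc, N₁, hN₁⟩ := h
  exact ⟨c, hc, N₁, fun k hk => hN₁ (2 ^ k) (le_trans hk (Nat.lt_two_pow_self).le)⟩

/-- Frame-level converse: `ConductanceLowerBound → InFrame DyadicFloorSeq`. -/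
theorem dyadicFloor_of_conductanceLowerBound (h : ConductanceLowerBound) : InFrame DyadicFloorSeq :=
  inFrame_mono (fun _ hD => dyadicFloorSeq_of_lowerSeq hD) (inFrame_lowerSeq_iff.mpr h)

/-- The doubling-Harnack piece is NOT implied by positivity alone but it also does not give the
floor alone: with (P) it yields the polynomial bound `θ^j · D_2 ≤ D_(2^j)` (iterate `j` doublings
from `N = 2`), recorded here in the simplest form `θ^j·D_2 ≤ D_{2^(j+1)}`. -/
theorem pow_mul_le_of_doublingHarnack {D : ℕ → ℝ} {θ : ℝ} (hθ : 0 < θ)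
    (hH : ∀ N M : ℕ, 2 ≤ N → N ≤ M → M ≤ 2 * N → θ * D N ≤ D M) :
    ∀ j : ℕ, θ ^ j * D 2 ≤ D (2 ^ (j + 1)) := by
  intro j
  induction j with
  | zero => simp
  | succ j ih =>
    have h2 : 2 ≤ 2 ^ (j + 1) := by
      calc (2 : ℕ) = 2 ^ 1 := by norm_num
        _ ≤ 2 ^ (j + 1) := Nat.pow_le_pow_right two_pos (by omega)
    have hstep := hH (2 ^ (j + 1)) (2 ^ (j + 2)) h2
      (Nat.pow_le_pow_right two_pos (by omega)) (by ring_nf; omega)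
    calc θ ^ (j + 1) * D 2 = θ * (θ ^ j * D 2) := by ring
      _ ≤ θ * D (2 ^ (j + 1)) := mul_le_mul_of_nonneg_left ih hθ.le
      _ ≤ D (2 ^ (j + 2)) := hstep

end Summit.AtomisticToContinuum.FouriersLaw.Cruxes.ConductanceLowerBound.StrategyCensusS2

end
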